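import Summits.HubbardSuperconductivity.HubbardSuperconductivity.Theorems.AnisotropyChordSpinAmplitudeStable
import Summits.HubbardSuperconductivity.HubbardSuperconductivity.Theorems.AnisotropyChordTowerProperPositionHolds
import Mathlib.Combinatorics.SimpleGraph.Connectivity.Connected
import Mathlib.Combinatorics.SimpleGraph.Finite

/-!
# Route `AnisotropyChord`: connectivity of the copy blow-up, A-STAB(S) on connected graphs, and
# THEOREM T-INT(S) — adjacent-sector spin-`n/2` ground states are in proper position
# (theory seat memo ROTOR-THEORY-6 §72: «A-STAB(S)/T-INT(S) by Grace–Walsh–Szegő», via the blow-up)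

* `blowUpGraph_connected` — for a connected graph on a non-trivial vertex set and `n ≥ 1` the copy
  blow-up `G.comap Prod.fst` is connected (copies of a site are linked through any neighbour).
* `xxzSpinGroundStateAmplitudeStable_of_connected` — A-STAB(S) with the hypotheses `G.Connected`,
  `Nontrivial V`, `0 < n`.
* **`xxzSpinTowerProperPosition`** — T-INT(S): for spin-`n/2` sector ground states `ψ` (sector `M`) and
  `φ` (sector `M − 1`) of `xxzHamiltonian n G (−1) Δ`, `Δ ∈ [−1,1]`, blow-up connected:
  `InProperPositionUpToPhase (spinAmpPoly n ψ) (spinAmpPoly n φ)` — from the spin-½ tree theorem T-INT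
  (`xxzTowerProperPosition_holds`) for `Jψ, Jφ` on the blow-up, specialised on the diagonal.

Theory seat `hubbard-h0-rotor-theory-1`.  No definition is introduced.
-/

set_option linter.dupNamespace false

noncomputable section

namespace Summit.HubbardSuperconductivity.HubbardSuperconductivity.Theorems.AnisotropyChord

open Matrix Complex Finset
open Literature.MathematicalPhysics.QuantumLattice

variable {V : Type} [Fintype V] [DecidableEq V]

/-! ### Connectivity of the blow-up -/

/-- The base-point section `x ↦ (x, i₀)` is a graph homomorphism `G →g blowUpGraph n G`. [folklore] -/
def blowUpSection (n : ℕ) (G : SimpleGraph V) (i₀ : Fin n) : G →g blowUpGraph n G where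
  toFun x := (x, i₀)
  map_rel' h := by simpa [SimpleGraph.comap_adj] using h

omit [DecidableEq V] in
/-- **The copy blow-up of a connected graph on a non-trivial vertex set is connected** (`n ≥ 1`): two
copies `(x,i)`, `(x,j)` of a site are joined through `(y, i₀)` for any neighbour `y` of `x`, and the
section `x ↦ (x, i₀)` carries walks of `G`. [folklore] -/
theorem blowUpGraph_connected (n : ℕ) (hn : 0 < n) (G : SimpleGraph V) [DecidableRel G.Adj]
    [Nontrivial V] (hG : G.Connected) : (blowUpGraph n G).Connected := by
  set i₀ : Fin n := ⟨0, hn⟩ with hi₀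
  -- every site has a neighbour
  have hdeg : ∀ x : V, ∃ y, G.Adj x y := fun x =>
    (G.degree_pos_iff_exists_adj x).mp (hG.preconnected.degree_pos_of_nontrivial x)
  -- every copy reaches the base copy of its site
  have hbase : ∀ a : V × Fin n, (blowUpGraph n G).Reachable a (a.1, i₀) := by
    rintro ⟨x, i⟩
    obtain ⟨y, hy⟩ := hdeg x
    have h1 : (blowUpGraph n G).Adj (x, i) (y, i₀) := by simpa [SimpleGraph.comap_adj] using hy
    have h2 : (blowUpGraph n G).Adj (y, i₀) (x, i₀) := by simpa [SimpleGraph.comap_adj] using hy.symm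
    exact h1.reachable.trans h2.reachable
  haveI : Nonempty (V × Fin n) := ⟨(Classical.arbitrary V, i₀)⟩
  refine ⟨fun a b => ?_⟩
  have hab : (blowUpGraph n G).Reachable (a.1, i₀) (b.1, i₀) :=
    (hG.preconnected a.1 b.1).map (blowUpSection n G i₀)
  exact ((hbase a).trans hab).trans (hbase b).symm

/-- **A-STAB(S) on connected graphs:** for `n ≥ 1`, a connected graph on a non-trivial vertex set,
`Δ ∈ [−1,1]` and a normalised spin-`n/2` sector ground state `χ` of `xxzHamiltonian n G (−1) Δ`, the
Dicke-normalised amplitude polynomial is stable. [folklore] -/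
theorem xxzSpinGroundStateAmplitudeStable_of_connected (n : ℕ) (hn : 0 < n) (G : SimpleGraph V)
    [DecidableRel G.Adj] [Nontrivial V] (hG : G.Connected) {M Δ : ℝ} (h1 : -1 ≤ Δ) (h2 : Δ ≤ 1)
    (χ : (V → Fin (n + 1)) → ℂ) (hχK : χ ∈ spinZSector (Λ := V) n M) (hχ1 : star χ ⬝ᵥ χ = 1)
    (hHχ : xxzHamiltonian n G (-1) Δ *ᵥ χ =
      ((lowestEnergyInSector n (xxzHamiltonian n G (-1) Δ) M : ℝ) : ℂ) • χ) :
    IsStable (spinAmpPoly n χ) :=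
  xxzSpinGroundStateAmplitudeStable n G (blowUpGraph_connected n hn G hG) h1 h2 χ hχK hχ1 hHχ

/-! ### T-INT(S) -/

/-- **THEOREM T-INT(S) (theory seat memo ROTOR-THEORY-6 §72).**  For every spin `n/2`, every graph whose
copy blow-up is connected, `Δ ∈ [−1,1]`, and normalised sector ground states `ψ` (sector `M`) and `φ`
(sector `M − 1`) of `xxzHamiltonian n G (−1) Δ`: the Dicke-normalised amplitude polynomials are in proper
position up to phases — every real combination `α c·a_ψ + β d·a_φ` is stable or vanishes on `ℍ^V`.
Proof: T-INT (`xxzTowerProperPosition_holds`) for `Jψ`, `Jφ` on the blow-up, on the diagonal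
`z'_{(x,i)} = z_x`. [folklore] -/
theorem xxzSpinTowerProperPosition (n : ℕ) (G : SimpleGraph V) [DecidableRel G.Adj]
    (hG' : (blowUpGraph n G).Connected) {M Δ : ℝ} (h1 : -1 ≤ Δ) (h2 : Δ ≤ 1)
    (ψ φ : (V → Fin (n + 1)) → ℂ)
    (hψK : ψ ∈ spinZSector (Λ := V) n M) (hψ1 : star ψ ⬝ᵥ ψ = 1)
    (hHψ : xxzHamiltonian n G (-1) Δ *ᵥ ψ =
      ((lowestEnergyInSector n (xxzHamiltonian n G (-1) Δ) M : ℝ) : ℂ) • ψ)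
    (hφK : φ ∈ spinZSector (Λ := V) n (M - 1)) (hφ1 : star φ ⬝ᵥ φ = 1)
    (hHφ : xxzHamiltonian n G (-1) Δ *ᵥ φ =
      ((lowestEnergyInSector n (xxzHamiltonian n G (-1) Δ) (M - 1) : ℝ) : ℂ) • φ) :
    InProperPositionUpToPhase (spinAmpPoly n ψ) (spinAmpPoly n φ) := by
  have hψ' := blowUpIso_mulVec_isSectorGroundState n G Δ M ψ hψK hψ1 hHψ
  have hφ' := blowUpIso_mulVec_isSectorGroundState n G Δ (M - 1) φ hφK hφ1 hHφ
  obtain ⟨c, d, hc, hd, hcomb⟩ :=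
    xxzTowerProperPosition_holds (V × Fin n) (blowUpGraph n G) hG' M Δ h1 h2 _ _ hψ' hφ'
  refine ⟨c, d, hc, hd, fun α β => ?_⟩
  rcases hcomb α β with hst | hzero
  · left
    intro z hz
    have h := hst (fun p : V × Fin n => z p.1) (fun p => hz p.1)
    simp only [ampPoly_blowUpIso_mulVec_diag] at h
    exact h
  · right
    intro z hz
    have h := hzero (fun p : V × Fin n => z p.1) (fun p => hz p.1)
    simp only [ampPoly_blowUpIso_mulVec_diag] at h
    exact h

/-- **T-INT(S) on connected graphs** (`n ≥ 1`, non-trivial vertex set). [folklore] -/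
theorem xxzSpinTowerProperPosition_of_connected (n : ℕ) (hn : 0 < n) (G : SimpleGraph V)
    [DecidableRel G.Adj] [Nontrivial V] (hG : G.Connected) {M Δ : ℝ} (h1 : -1 ≤ Δ) (h2 : Δ ≤ 1)
    (ψ φ : (V → Fin (n + 1)) → ℂ)
    (hψK : ψ ∈ spinZSector (Λ := V) n M) (hψ1 : star ψ ⬝ᵥ ψ = 1)
    (hHψ : xxzHamiltonian n G (-1) Δ *ᵥ ψ =
      ((lowestEnergyInSector n (xxzHamiltonian n G (-1) Δ) M : ℝ) : ℂ) • ψ)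
    (hφK : φ ∈ spinZSector (Λ := V) n (M - 1)) (hφ1 : star φ ⬝ᵥ φ = 1)
    (hHφ : xxzHamiltonian n G (-1) Δ *ᵥ φ =
      ((lowestEnergyInSector n (xxzHamiltonian n G (-1) Δ) (M - 1) : ℝ) : ℂ) • φ) :
    InProperPositionUpToPhase (spinAmpPoly n ψ) (spinAmpPoly n φ) :=
  xxzSpinTowerProperPosition n G (blowUpGraph_connected n hn G hG) h1 h2 ψ φ hψK hψ1 hHψ hφK hφ1 hHφ

end Summit.HubbardSuperconductivity.HubbardSuperconductivity.Theorems.AnisotropyChord
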